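import Summits.QuantumFields.BalabanUV.T4Continuum.Support.BalabanAveragedTowerUnit
import Literature.MathematicalPhysics.QuantumFieldTheory.Balaban1983to89.Beta.InfiniteVolume

/-!
# `BalabanUV.Beta.GAN24.VolumeLimitAlgebra` — binder row G-an2-4 ∕ (CONV-C), route R7 «TWO CURRENCIES», PART 136: TWO GENERIC TOOLS FOR THE ONE DISPLAYED HYPOTHESIS OF PART 134
# (`IsInfiniteVolumeLimit` for the effective form).  (A) NEUMANN–TANNERY: for a volume-indexed family of matrices `A_t` with `‖1 − τA_t‖ ≤ q < 1` UNIFORMLY in `t` (uniform coercivity and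
# boundedness), the inverse is `A_t⁻¹ = τΣ_i(1 − τA_t)^i` with the `i`-th entry bounded by `q^i` uniformly in `t`; hence IF the entries of the POWERS `(1 − τA_t)^i` read at volume-dependent
# sites converge as `t → ∞` for every `i`, SO DO the entries of `A_t⁻¹` (dominated convergence in `i`) — no `ℤ^d` operator, no infinite matrix.  (B) CONVOLUTION CLOSURE: in the β-cell's
# carriers (`Site d (side t)`, `IsInfiniteVolumeLimit`, `InfiniteVolume.UniformDecay`), infinite-volume limits of translation-invariant torus kernels are CLOSED under torus convolution
# (with the direction index summed) when one factor is volume-uniformly bounded and the other volume-uniformly decaying, the limit being the `ℤ^d` convolution (Tannery over the window);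
# plus the δ-kernel and linear closure.  (A) + (B) are steps (iii) and (ii) of the located route (census V177): powers of `1 − τc_k` are iterated convolutions of the unit-torus kernel of
# `c_k = L^{dk}Q_k𝒢Q_kᴴ`, so `IsInfiniteVolumeLimit` for `c_k` + (UD)_vol ⟹ the same for every power ⟹ for `c_k⁻¹` ⟹ for `Σ_k = c_k⁻¹ − a·1` (the instance is PART 137's business)
# (unit b2b-balaban-gan24-p3, gen 53; v1)

NOT IN PRINT; OUR PROOF ([folklore] BY NAME over Mathlib's Neumann series in a complete normed ring (`geom_series_mul_neg`, `summable_geometric_of_norm_lt_one`, `norm_pow_le'`), `Matrix.inv_eq_left_inv`,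
`tendsto_tsum_of_dominated_convergence`, NE2's `BalabanAveragedTowerUnit.norm_entry_le_opNorm` (`‖A x y‖ ≤ ‖A‖` in the `ℓ²`-operator norm), the β-cell's `Beta.InfiniteVolume` (`windowExt`,
`sum_eq_tsum_windowExt`, `eventually_inWindow`, `windowMap_siteOf`, `UniformDecay`) and `B12Sec2to5.summable_exp_neg_l1`; nothing printed is a hypothesis).
HONEST FRAMING (cell contract, verbatim): «discharging `BetaPertH` makes Bałaban's UV stability UNCONDITIONAL — a real constructive-QFT result; it is NOT the
continuum limit and NOT the Clay problem.»  HONEST DEPENDENCY (verbatim): «continuum YM on T⁴ ⇐ BetaPertH ∧ nine spine estimates (0/9 proved); BetaPertH ⇐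
(D1) ∧ (D4) ∧ CAP+tail; G-an2-4 gates asym, D1 and NE2/3/4.»

WHAT THIS FILE PROVES (0 sorry, 0 `def`, nothing cited):
* §1 (A) `inv_eq_smul_tsum_pow` (`‖1 − τ•A‖ < 1` ⟹ `A⁻¹ = τ • Σ' i, (1 − τ•A)^i`), `inv_apply_eq_tsum` (entrywise), `norm_pow_apply_le` (`‖((1 − τ•A)^i) x y‖ ≤ q^i`),
  **`tendsto_inv_apply_of_tendsto_pow_apply`** — `ι : ℕ → Type` finite index sets, `A t : Matrix (ι t) (ι t) ℂ`, `‖1 − τ•A t‖ ≤ q < 1` for all `t`, sites `x t, y t : ι t`, and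
  `∀ i, ((1 − τ•A t)^i) (x t) (y t) → p i` ⟹ `Summable p` and `(A t)⁻¹ (x t) (y t) → τ·Σ' i, p i`.
* §2 (B) `siteOf_sub'` (casts), **`isInfiniteVolumeLimit_conv`** — `side t → ∞`, `IsInfiniteVolumeLimit side P Π`, `IsInfiniteVolumeLimit side Q Ξ`, `|P t μ ν z| ≤ B`, `UniformDecay side Q C δ` (`δ > 0`)
  ⟹ `IsInfiniteVolumeLimit side (t μ ν z ↦ Σ_λ Σ_w P t μ λ (z − w)·Q t λ ν w) (μ ν z ↦ Σ_λ Σ'_w Π μ λ (z − w)·Ξ λ ν w)`; `isInfiniteVolumeLimit_kdelta` (the unit kernel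
  `[z = 0][μ = ν]`), `isInfiniteVolumeLimit_add ∕ _sub ∕ _smul`.
WHAT IT DOES NOT DO: instantiate anything on Bałaban's objects (PART 137: the unit-torus kernel of `c_k`, its translation invariance, `‖1 − τc_k‖ ≤ 1 − γ_B∕Λ`, and `IsInfiniteVolumeLimit` for
`c_k` itself from the fine-level Green's function); (UD)_vol of convolutions (PART 127 ∕ 130 per torus + PART 134's dictionary).  SUPPLIER work; no consumer of record; NEVER «G-an2-4 closed»;
NOT (CONV-C), NOT D1, NOT `BetaPertH`, NOT continuum, NOT Clay.  Records: `HOME/b2b-balaban-gan24-p3/gen53/README.md`.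
-/

noncomputable section

open scoped BigOperators Matrix Matrix.Norms.L2Operator
open Filter Topology

namespace Summit.QuantumFields.BalabanUV.Beta.GAN24.VolumeLimitAlgebra

open Literature.MathematicalPhysics.QuantumFieldTheory.Balaban1983to89
open Literature.MathematicalPhysics.QuantumFieldTheory.Balaban1983to89.B12Sec2to5 (l1 summable_exp_neg_l1)
open Literature.MathematicalPhysics.QuantumFieldTheory.Balaban1983to89.Beta
  (Site windowMap windowExt siteOf InWindow IsInfiniteVolumeLimit windowExt_of_inWindow windowExt_of_not_inWindow windowMap_siteOf sum_eq_tsum_windowExt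
   eventually_inWindow)
open Summit.QuantumFields.BalabanUV.T4Continuum.BalabanAveragedTowerUnit (norm_entry_le_opNorm)

/-! ## §1 (A) Neumann–Tannery: entries of inverses converge when entries of powers do -/

section Neumann

variable {n : Type*} [Fintype n] [DecidableEq n]

/-- the Neumann series for the inverse: `‖1 − τ•A‖ < 1` ⟹ `A⁻¹ = τ • Σ' i, (1 − τ•A)^i` (`(Σ' Bⁱ)(1 − B) = 1` with `1 − B = τ•A`). [folklore] -/
theorem inv_eq_smul_tsum_pow {A : Matrix n n ℂ} (τ : ℂ) (h : ‖1 - τ • A‖ < 1) : A⁻¹ = τ • ∑' i, (1 - τ • A) ^ i := by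
  have key : (∑' i, (1 - τ • A) ^ i) * (1 - (1 - τ • A)) = 1 := geom_series_mul_neg _ h
  rw [sub_sub_cancel, Matrix.mul_smul] at key
  exact Matrix.inv_eq_left_inv (by rw [Matrix.smul_mul]; exact key)

/-- … entrywise: `A⁻¹ x y = τ·Σ' i, ((1 − τ•A)^i) x y`. [folklore] -/
theorem inv_apply_eq_tsum {A : Matrix n n ℂ} (τ : ℂ) (h : ‖1 - τ • A‖ < 1) (x y : n) : A⁻¹ x y = τ * ∑' i, ((1 - τ • A) ^ i : Matrix n n ℂ) x y := by
  have hs : Summable fun i => (1 - τ • A) ^ i := summable_geometric_of_norm_lt_one h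
  have hcont : Continuous fun M : Matrix n n ℂ => M x y := (continuous_apply y).comp (continuous_apply x)
  have h1 : HasSum (fun i => ((1 - τ • A) ^ i : Matrix n n ℂ) x y) ((∑' i, (1 - τ • A) ^ i : Matrix n n ℂ) x y) :=
    hs.hasSum.map (AddMonoidHom.mk' (fun M : Matrix n n ℂ => M x y) (fun _ _ => rfl)) hcont
  rw [inv_eq_smul_tsum_pow τ h, Matrix.smul_apply, smul_eq_mul, h1.tsum_eq]

/-- entries of the powers: `‖1 − τ•A‖ ≤ q` ⟹ `‖((1 − τ•A)^i) x y‖ ≤ q^i`. [folklore] -/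
theorem norm_pow_apply_le {A : Matrix n n ℂ} {τ : ℂ} {q : ℝ} (h : ‖1 - τ • A‖ ≤ q) (i : ℕ) (x y : n) : ‖((1 - τ • A) ^ i : Matrix n n ℂ) x y‖ ≤ q ^ i := by
  rcases Nat.eq_zero_or_pos i with rfl | hi
  · rw [pow_zero, pow_zero]
    by_cases hxy : x = y
    · subst hxy; rw [Matrix.one_apply_eq, norm_one]
    · rw [Matrix.one_apply_ne hxy, norm_zero]; exact zero_le_one
  · exact (norm_entry_le_opNorm _ x y).trans ((norm_pow_le' _ hi).trans (pow_le_pow_left₀ (norm_nonneg _) h i))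

/-- **`tendsto_inv_apply_of_tendsto_pow_apply` — NEUMANN–TANNERY** [folklore]: finite index sets `ι t`, matrices `A t` with `‖1 − τ•A t‖ ≤ q < 1` for ALL `t`, volume-dependent sites
`x t, y t`, and convergence of the entries of every power, `((1 − τ•A t)^i) (x t) (y t) → p i` ⟹ `Summable p` and `(A t)⁻¹ (x t) (y t) → τ·Σ' i, p i` (dominated convergence in `i`
with the volume-uniform majorant `q^i`). -/
theorem tendsto_inv_apply_of_tendsto_pow_apply {ι : ℕ → Type*} [∀ t, Fintype (ι t)] [∀ t, DecidableEq (ι t)] {A : (t : ℕ) → Matrix (ι t) (ι t) ℂ} {τ : ℂ} {q : ℝ}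
    (hq1 : q < 1) (hA : ∀ t, ‖1 - τ • A t‖ ≤ q) (x y : (t : ℕ) → ι t) {p : ℕ → ℂ}
    (hp : ∀ i, Tendsto (fun t => ((1 - τ • A t) ^ i : Matrix (ι t) (ι t) ℂ) (x t) (y t)) atTop (𝓝 (p i))) :
    Summable p ∧ Tendsto (fun t => (A t)⁻¹ (x t) (y t)) atTop (𝓝 (τ * ∑' i, p i)) := by
  have hq0 : 0 ≤ q := (norm_nonneg _).trans (hA 0)
  have hbound : ∀ t i, ‖((1 - τ • A t) ^ i : Matrix (ι t) (ι t) ℂ) (x t) (y t)‖ ≤ q ^ i := fun t i => norm_pow_apply_le (hA t) i _ _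
  have hgeo : Summable fun i : ℕ => q ^ i := summable_geometric_of_lt_one hq0 hq1
  have hT : Tendsto (fun t => ∑' i, ((1 - τ • A t) ^ i : Matrix (ι t) (ι t) ℂ) (x t) (y t)) atTop (𝓝 (∑' i, p i)) :=
    tendsto_tsum_of_dominated_convergence hgeo hp (Eventually.of_forall fun t i => hbound t i)
  refine ⟨?_, ?_⟩
  · refine Summable.of_norm_bounded hgeo fun i => ?_
    exact le_of_tendsto' ((continuous_norm.tendsto _).comp (hp i)) fun t => hbound t i
  · have e : ∀ t, (A t)⁻¹ (x t) (y t) = τ * ∑' i, ((1 - τ • A t) ^ i : Matrix (ι t) (ι t) ℂ) (x t) (y t) := fun t => inv_apply_eq_tsum τ ((hA t).trans_lt hq1) _ _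
    simp_rw [e]
    exact hT.const_mul τ

end Neumann

/-! ## §2 (B) Infinite-volume limits are closed under torus convolution -/

section Convolution

variable {d : ℕ} {side : ℕ → ℕ} [∀ t, NeZero (side t)]

omit [∀ t, NeZero (side t)] in
/-- casts: `siteOf (x − y) = siteOf x − siteOf y`. [folklore] -/
theorem siteOf_sub' (s : ℕ) (x y : Fin d → ℤ) : siteOf d s (x - y) = siteOf d s x - siteOf d s y := by
  funext i; simp [siteOf]

/-- **`isInfiniteVolumeLimit_conv` — CONVOLUTION CLOSURE** [folklore]: torus sides `side t → ∞`, `IsInfiniteVolumeLimit side P Π`, `IsInfiniteVolumeLimit side Q Ξ`, a volume-uniform bound `|P t μ ν z| ≤ B`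
and volume-uniform decay `UniformDecay side Q C δ` (`δ > 0`) ⟹ the torus convolutions `Σ_λ Σ_w P t μ λ (z − w)·Q t λ ν w` converge at every `ℤ^d` point to the `ℤ^d` convolution
`Σ_λ Σ'_w Π μ λ (z − w)·Ξ λ ν w` (Tannery over the window with the majorant `B·C·e^{−δ|w|₁}`). -/
theorem isInfiniteVolumeLimit_conv (hside : Tendsto side atTop atTop) {P Q : (t : ℕ) → Fin d → Fin d → Site d (side t) → ℝ} {Pinf Qinf : B12Beta.Kernel d}
    (hP : IsInfiniteVolumeLimit side P Pinf) (hQ : IsInfiniteVolumeLimit side Q Qinf) {B C δ : ℝ} (hB : ∀ t μ ν z, |P t μ ν z| ≤ B)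
    (hQd : Beta.UniformDecay side Q C δ) (hδ : 0 < δ) :
    IsInfiniteVolumeLimit side (fun t μ ν z => ∑ l, ∑ w : Site d (side t), P t μ l (z - w) * Q t l ν w)
      (fun μ ν z => ∑ l, ∑' w : Fin d → ℤ, Pinf μ l (z - w) * Qinf l ν w) := by
  classical
  intro μ ν x
  refine tendsto_finsetSum _ fun l _ => ?_
  have hB0 : 0 ≤ B := (abs_nonneg _).trans (hB 0 μ l 0)
  have hC0 : 0 ≤ C := hQd.nonneg l ν
  -- the torus sum as a `tsum` over `ℤ^d` of the window extension
  have e : ∀ t, (∑ w : Site d (side t), P t μ l ((fun i => (x i : ZMod (side t))) - w) * Q t l ν w)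
      = ∑' y : Fin d → ℤ, windowExt (fun w => P t μ l ((fun i => (x i : ZMod (side t))) - w) * Q t l ν w) y := fun t => sum_eq_tsum_windowExt _
  simp_rw [e]
  refine tendsto_tsum_of_dominated_convergence ((summable_exp_neg_l1 hδ d).mul_left (B * C)) (fun y => ?_) (Eventually.of_forall fun t y => ?_)
  · -- pointwise: eventually `y` is inside the window
    have hxy : (fun t => P t μ l ((fun i => (x i : ZMod (side t))) - fun i => (y i : ZMod (side t))) * Q t l ν (fun i => (y i : ZMod (side t))))
        =ᶠ[atTop] fun t => windowExt (fun w => P t μ l ((fun i => (x i : ZMod (side t))) - w) * Q t l ν w) y := by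
      filter_upwards [eventually_inWindow hside y] with t ht
      rw [windowExt_of_inWindow _ ht]; rfl
    refine Tendsto.congr' hxy ?_
    have h1 : Tendsto (fun t => P t μ l ((fun i => (x i : ZMod (side t))) - fun i => (y i : ZMod (side t)))) atTop (𝓝 (Pinf μ l (x - y))) := by
      have := hP μ l (x - y)
      refine this.congr' (Eventually.of_forall fun t => ?_)
      show P t μ l (fun i => ((x - y) i : ZMod (side t))) = _
      congr 1; funext i; push_cast [Pi.sub_apply]; ring
    exact h1.mul (hQ l ν y)
  · -- domination by `B·C·e^{−δ|y|₁}`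
    rw [Real.norm_eq_abs]
    by_cases hy : ∀ i, InWindow (side t) (y i)
    · rw [windowExt_of_inWindow _ hy, abs_mul]
      have h2 := hQd t l ν (siteOf d (side t) y)
      rw [windowMap_siteOf d (side t) hy] at h2
      calc |P t μ l _| * |Q t l ν (siteOf d (side t) y)| ≤ B * (C * Real.exp (-δ * l1 y)) := mul_le_mul (hB t μ l _) h2 (abs_nonneg _) hB0
        _ = B * C * Real.exp (-δ * l1 y) := by ring
    · rw [windowExt_of_not_inWindow _ hy, abs_zero]; positivity

omit [∀ t, NeZero (side t)] in
/-- the unit kernel `[z = 0]·[μ = ν]` (the identity matrix as a translation-invariant kernel) has the infinite-volume limit `[z = 0]·[μ = ν]` (a fixed `z ∈ ℤ^d` is `0 mod side t` for large `t`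
iff `z = 0`). [folklore] -/
theorem isInfiniteVolumeLimit_kdelta [∀ t, NeZero (side t)] (hside : Tendsto side atTop atTop) :
    IsInfiniteVolumeLimit side (fun t μ ν (z : Site d (side t)) => if z = 0 ∧ μ = ν then (1 : ℝ) else 0)
      (fun μ ν z => if z = 0 ∧ μ = ν then 1 else 0) := by
  intro μ ν x
  refine tendsto_const_nhds.congr' ?_
  filter_upwards [eventually_inWindow hside x, eventually_inWindow hside 0] with t hx h0
  have key : ((fun i => (x i : ZMod (side t))) = 0) ↔ x = 0 := by
    constructor
    · intro h
      have e1 : windowMap d (side t) (siteOf d (side t) x) = x := windowMap_siteOf d (side t) hx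
      have e2 : siteOf d (side t) x = siteOf d (side t) 0 := by
        funext i; have := congrFun h i; simpa [siteOf] using this
      rw [e2, windowMap_siteOf d (side t) h0] at e1
      exact e1.symm
    · rintro rfl; funext i; simp
  simp only [key]

omit [∀ t, NeZero (side t)] in
/-- linear closure: sums. [folklore] -/
theorem isInfiniteVolumeLimit_add [∀ t, NeZero (side t)] {P Q : (t : ℕ) → Fin d → Fin d → Site d (side t) → ℝ} {Pinf Qinf : B12Beta.Kernel d}
    (hP : IsInfiniteVolumeLimit side P Pinf) (hQ : IsInfiniteVolumeLimit side Q Qinf) :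
    IsInfiniteVolumeLimit side (fun t μ ν z => P t μ ν z + Q t μ ν z) (fun μ ν z => Pinf μ ν z + Qinf μ ν z) :=
  fun μ ν x => (hP μ ν x).add (hQ μ ν x)

omit [∀ t, NeZero (side t)] in
/-- linear closure: differences. [folklore] -/
theorem isInfiniteVolumeLimit_sub [∀ t, NeZero (side t)] {P Q : (t : ℕ) → Fin d → Fin d → Site d (side t) → ℝ} {Pinf Qinf : B12Beta.Kernel d}
    (hP : IsInfiniteVolumeLimit side P Pinf) (hQ : IsInfiniteVolumeLimit side Q Qinf) :
    IsInfiniteVolumeLimit side (fun t μ ν z => P t μ ν z - Q t μ ν z) (fun μ ν z => Pinf μ ν z - Qinf μ ν z) :=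
  fun μ ν x => (hP μ ν x).sub (hQ μ ν x)

omit [∀ t, NeZero (side t)] in
/-- linear closure: fixed scalars. [folklore] -/
theorem isInfiniteVolumeLimit_smul [∀ t, NeZero (side t)] {P : (t : ℕ) → Fin d → Fin d → Site d (side t) → ℝ} {Pinf : B12Beta.Kernel d}
    (hP : IsInfiniteVolumeLimit side P Pinf) (c : ℝ) :
    IsInfiniteVolumeLimit side (fun t μ ν z => c * P t μ ν z) (fun μ ν z => c * Pinf μ ν z) :=
  fun μ ν x => (hP μ ν x).const_mul c

end Convolution

end Summit.QuantumFields.BalabanUV.Beta.GAN24.VolumeLimitAlgebra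

end
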